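import Literature.NumberTheory.GaloisRepresentations.UnramifiedAdmissible
import Literature.NumberTheory.GaloisRepresentations.CrystallineDeformationRing
import Literature.NumberTheory.GaloisRepresentations.LabelledHodgeTateWeights
import HarnessLib

/-!
# The `F̂_nr` `p`-adic Hodge datum: admissible ⇒ unramified, Hodge–Tate weights, Weil–Deligne part

Let `F` be a non-archimedean local field with a `ℚ_p`-algebra structure and `𝔅 = F̂_nr`
(`unramifiedPeriodRingData F p`, the inertia invariants `(B_dR)^{I_F}` with the induced — trivial —
filtration).  This file completes the verification that `F̂_nr` together with the Weil–Deligne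
recipe `ρ ↦ (ρ|_{W_F}, N = 0)` is a `PstWeilDeligneData F p` (accepted structure) and records its
basic properties:

* `PeriodRingData.apply_eq_self_of_isAdmissible` — for ANY period-ring datum, an element `σ`
  acting trivially on `B` acts trivially on every `B`-admissible representation (Fontaine's
  comparison isomorphism; here: `linearIndependent_of_mem_D` and a rank count).  Hence
  (`FramedRep.isLocallyUnramified_of_isDeRhamWith_unramifiedPeriodRingData`) **`F̂_nr`-admissible
  = unramified** (Fontaine 1994, Exp. III Prop. 1.6.2 / Fontaine–Ouyang Prop. 2.14; Sen: the
  `ℂ_p`- resp. `K̂^nr`-admissible representations are the potentially unramified resp.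
  unramified ones).
* `PeriodRingData.hodgeTateWeights_eq_replicate_of_fil_trivial` — for a datum with the trivial
  filtration (`Fil^i = B` for `i ≤ 0`, `0` for `i > 0`) the Hodge–Tate weights of any `ρ` are
  `{0, …, 0}` (`dim D` times); so (`unramifiedPstWeilDeligneData_unramifiedWeightsZero`)
  unramified representations have all weights `0` (`PstWeilDeligneData.UnramifiedWeightsZero`).
* `unramifiedPstWeilDeligneData F p : PstWeilDeligneData F p` — the datum: `𝔅 = F̂_nr`,
  `IsWeilDeligneOf ρ r :↔ r.N = 0 ∧ r.ρ ≅ ρ|_{W_F}` (Tate, Corvallis (4.1.3): the Weil–Deligne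
  representation of an unramified `ℓ`-adic-type representation; for crystalline = unramified
  `ρ` this is `N = 0`, inertia trivial, Fontaine 1994 Exp. VIII §1.3), with all seven axioms
  PROVED (`exists_of_isDeRham` uses admissible ⇒ unramified; `isDeRhamWith_of_isLocallyUnramified`
  is `FramedRep.isDeRhamWith_unramifiedPeriodRingData_of_isLocallyUnramified`, Lang's theorem).

No named facts; no `sorry`.

## References

* J.-M. Fontaine, Astérisque 223 (1994), Exp. III §1.5–1.6, Exp. VIII §1.3. [FontaineAsterisque223III]
* J. Tate, *Number theoretic background*, Corvallis 1979, (4.1.3), (4.1.6). [TateCorvallis1979]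
-/

noncomputable section

open ValuativeRel Field IsLocalRing Matrix TensorProduct
open scoped MatrixGroups TensorProduct

namespace Literature.NumberTheory.GaloisRepresentations

universe u w w'

/-! ### Admissible representations are trivial on elements acting trivially on `B` -/

section Inertia

universe u₁ u₂ u₃ u₄ u₅

variable {Γ : Type u₁} [Group Γ] [TopologicalSpace Γ] {P : Type u₂} {E : Type u₃} [Field P]
  [TopologicalSpace P] [Field E] [Algebra P E]
  {M : Type u₅} [AddCommGroup M] [Module P M] [TopologicalSpace M]

-- Mathlib's own global value of `maxSynthPendingDepth` (nested instances on `𝔅.B ⊗[P] M`;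
-- see the note in `PAdicHodgeProofs`).
omit [TopologicalSpace Γ] [TopologicalSpace P] [TopologicalSpace M] in
set_option maxSynthPendingDepth 3 in
/-- `m ↦ 1 ⊗ m : M → B ⊗_P M` is injective (`B` a nonzero algebra over the field `P`). [folklore] -/
theorem PeriodRingData.injective_one_tmul (𝔅 : PeriodRingData.{u₁, u₂, u₃, u₄} Γ P E) :
    Function.Injective fun m : M => (1 : 𝔅.B) ⊗ₜ[P] m := by
  classical
  intro m m' h
  let b := Module.Free.chooseBasis P M
  have h1 := congrArg (Algebra.TensorProduct.basis 𝔅.B b).repr h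
  simp only [Algebra.TensorProduct.basis_repr_tmul, one_smul] at h1
  exact b.repr.injective (Finsupp.mapRange_injective _ (map_zero _) (algebraMap P 𝔅.B).injective h1)

-- Mathlib's own global value of `maxSynthPendingDepth` (see above).
set_option maxSynthPendingDepth 3 in
/-- **Admissible representations are trivial on the kernel of the action on `B`.** For any
period-ring datum `𝔅` and any finite-dimensional `B`-admissible `ρ`, an element `σ ∈ Γ` acting
trivially on `B` acts trivially on `V`: by Fontaine's injectivity (`linearIndependent_of_mem_D`) an
`E`-basis of `D_B(V)` is `B`-linearly independent in the rank-`dim V` free `B`-module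
`B ⊗_P V`, so for each `v` some nonzero multiple `c (1 ⊗ v)` is a `B`-combination of invariant
vectors with `σ`-fixed coefficients; applying `σ` gives `c (1 ⊗ ρ(σ) v) = c (1 ⊗ v)`
(Fontaine 1994, Exp. III §1.5; Fontaine–Ouyang Thm. 2.13 (2): `α_V` is an isomorphism for
admissible `V`). [cite: FontaineAsterisque223III, Exp. III §1.5] -/
theorem PeriodRingData.apply_eq_self_of_isAdmissible (𝔅 : PeriodRingData.{u₁, u₂, u₃, u₄} Γ P E)
    (ρ : ContinuousRep Γ P M) [FiniteDimensional P M] (hadm : 𝔅.IsAdmissible ρ) {σ : Γ}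
    (hσ : ∀ b : 𝔅.B, σ • b = b) (v : M) : ρ σ v = v := by
  classical
  set N := Module.finrank P M with hN
  by_cases hN0 : N = 0
  · have hv : v = 0 := by
      by_contra hv
      exact (Module.finrank_pos_iff_exists_ne_zero.2 ⟨v, hv⟩).ne' hN0
    rw [hv, map_zero]
  haveI : Module.Finite E (𝔅.D ρ) :=
    Module.finite_of_finrank_pos (by rw [show Module.finrank E (𝔅.D ρ) = N from hadm]; omega)
  let d := Module.finBasisOfFinrankEq E (𝔅.D ρ) hadm
  let d' : Fin N → 𝔅.B ⊗[P] M := fun j => (d j : 𝔅.B ⊗[P] M)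
  have hd' : LinearIndependent 𝔅.B d' :=
    𝔅.linearIndependent_of_mem_D ρ (fun j => (d j).2)
      (d.linearIndependent.map' (𝔅.D ρ).subtype (Submodule.ker_subtype _))
  -- `1 ⊗ v` together with `d'` is linearly dependent over `B`
  have hdep : ¬ LinearIndependent 𝔅.B (Fin.cons ((1 : 𝔅.B) ⊗ₜ[P] v) d' : Fin (N + 1) → 𝔅.B ⊗[P] M) := by
    intro h
    have h1 := h.fintype_card_le_finrank
    rw [Fintype.card_fin, Module.finrank_baseChange] at h1
    omega
  simp only [Fintype.linearIndependent_iff, not_forall, exists_prop] at hdep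
  obtain ⟨g, hg, i, hi⟩ := hdep
  rw [Fin.sum_univ_succ] at hg
  simp only [Fin.cons_zero, Fin.cons_succ] at hg
  have hg0 : g 0 ≠ 0 := by
    intro h0
    rw [h0, zero_smul, zero_add] at hg
    have h1 := Fintype.linearIndependent_iff.1 hd' (fun j => g j.succ) hg
    rcases Fin.eq_zero_or_eq_succ i with h2 | ⟨j, rfl⟩
    · exact hi (h2 ▸ h0)
    · exact hi (h1 j)
  -- apply `σ`
  have key : ∀ j, 𝔅.tensorRep ρ σ (d' j) = d' j := fun j => (𝔅.mem_D_iff ρ _).1 (d j).2 σ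
  have hσg : 𝔅.tensorRep ρ σ (g 0 • ((1 : 𝔅.B) ⊗ₜ[P] v)) = g 0 • ((1 : 𝔅.B) ⊗ₜ[P] ρ σ v) := by
    rw [PeriodRingData.tensorRep_apply_smul, hσ, PeriodRingData.tensorRep_apply_tmul, smul_one]
  have hrel : g 0 • ((1 : 𝔅.B) ⊗ₜ[P] v) = -∑ j, g j.succ • d' j := eq_neg_of_add_eq_zero_left hg
  have hσsum : 𝔅.tensorRep ρ σ (∑ j, g j.succ • d' j) = ∑ j, g j.succ • d' j := by
    rw [map_sum]
    exact Finset.sum_congr rfl fun j _ => by rw [PeriodRingData.tensorRep_apply_smul, hσ, key]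
  have h2 : g 0 • ((1 : 𝔅.B) ⊗ₜ[P] ρ σ v) = g 0 • ((1 : 𝔅.B) ⊗ₜ[P] v) := by
    rw [← hσg, hrel, map_neg, hσsum]
  have h3 : (1 : 𝔅.B) ⊗ₜ[P] ρ σ v = (1 : 𝔅.B) ⊗ₜ[P] v := smul_right_injective _ hg0 h2
  exact 𝔅.injective_one_tmul h3

end Inertia

/-! ### Hodge–Tate weights for the trivial filtration -/

section Weights

universe u₁ u₂ u₃ u₄ u₅

variable {Γ : Type u₁} [Group Γ] [TopologicalSpace Γ] {P : Type u₂} {E : Type u₃} [Field P]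
  [TopologicalSpace P] [Field E] [Algebra P E]
  {M : Type u₅} [AddCommGroup M] [Module P M] [TopologicalSpace M]

-- Mathlib's own global value of `maxSynthPendingDepth` (nested instances on `𝔅.B ⊗[P] M`).
omit [TopologicalSpace Γ] [TopologicalSpace P] [TopologicalSpace M] in
set_option maxSynthPendingDepth 3 in
/-- `Fil^i B = B` gives `Fil^i (B ⊗ M) = B ⊗ M`. [folklore] -/
theorem PeriodRingData.filTensor_eq_top (𝔅 : PeriodRingData.{u₁, u₂, u₃, u₄} Γ P E) {i : ℤ}
    (h : 𝔅.fil i = ⊤) : 𝔅.filTensor M i = ⊤ := by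
  rw [eq_top_iff]
  rintro x -
  induction x using TensorProduct.induction_on with
  | zero => exact zero_mem _
  | tmul b m =>
    have hb : b ∈ 𝔅.fil i := by rw [h]; exact Submodule.mem_top
    exact ⟨(⟨b, hb⟩ : 𝔅.fil i) ⊗ₜ[P] m, rfl⟩
  | add x y hx hy => exact Submodule.add_mem _ hx hy

-- Mathlib's own global value of `maxSynthPendingDepth` (nested instances on `𝔅.B ⊗[P] M`).
omit [TopologicalSpace Γ] [TopologicalSpace P] [TopologicalSpace M] in
set_option maxSynthPendingDepth 3 in
/-- `Fil^i B = 0` gives `Fil^i (B ⊗ M) = 0`. [folklore] -/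
theorem PeriodRingData.filTensor_eq_bot (𝔅 : PeriodRingData.{u₁, u₂, u₃, u₄} Γ P E) {i : ℤ}
    (h : 𝔅.fil i = ⊥) : 𝔅.filTensor M i = ⊥ := by
  rw [eq_bot_iff]
  rintro x ⟨y, rfl⟩
  rw [Submodule.mem_bot]
  induction y using TensorProduct.induction_on with
  | zero => rw [map_zero]
  | tmul b m =>
    have hb : (b : 𝔅.B) = 0 := by
      have h2 : ∀ x ∈ 𝔅.fil i, x = (0 : 𝔅.B) := fun x hx => by
        rw [h] at hx
        exact (Submodule.mem_bot E).1 hx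
      exact h2 b b.2
    rw [TensorProduct.AlgebraTensorModule.map_tmul, Submodule.subtype_apply, hb, TensorProduct.zero_tmul]
  | add x y hx hy => rw [map_add, hx, hy, add_zero]

/-- **Hodge–Tate weights for the trivial filtration.** If `Fil^i B = B` for `i ≤ 0` and
`Fil^i B = 0` for `i > 0`, then the Hodge–Tate weights of every `ρ` are `{0, …, 0}`
(`dim_E D_B(V)` times): `Fil^i D = D` for `i ≤ 0` and `0` for `i > 0`. [folklore] -/
theorem PeriodRingData.hodgeTateWeights_eq_replicate_of_fil_trivial
    (𝔅 : PeriodRingData.{u₁, u₂, u₃, u₄} Γ P E) (h0 : ∀ i : ℤ, i ≤ 0 → 𝔅.fil i = ⊤)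
    (h1 : ∀ i : ℤ, 0 < i → 𝔅.fil i = ⊥) (ρ : ContinuousRep Γ P M) :
    𝔅.hodgeTateWeights ρ = Multiset.replicate (Module.finrank E (𝔅.D ρ)) 0 := by
  rw [hodgeTateWeights_eq_jumpMultiset, ← jumpMultiset_step]
  congr 1
  funext i
  by_cases hi : i ≤ 0
  · rw [if_pos hi, PeriodRingData.filD, 𝔅.filTensor_eq_top (h0 i hi), Submodule.comap_top, finrank_top]
  · rw [if_neg hi, PeriodRingData.filD, 𝔅.filTensor_eq_bot (h1 i (not_le.1 hi)), Submodule.comap_bot,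
      Submodule.ker_subtype, finrank_bot]

end Weights

/-! ### The `F̂_nr` datum -/

namespace IsNonarchimedeanLocalField

variable {F : Type u} [Field F] [ValuativeRel F] [TopologicalSpace F] [IsNonarchimedeanLocalField F]

/-- **The inertia group acts trivially on `F̂_nr`.** [cite: SerreLocalFields1979, Ch. XIII §5] -/
theorem unramifiedPeriodField.smul_eq_self_of_mem_absInertia {σ : absoluteGaloisGroup F}
    (hσ : σ ∈ absInertia F) (b : unramifiedPeriodField F) : σ • b = b := by
  obtain ⟨x, y, -, rfl⟩ := IsFractionRing.div_surjective (A := maxUnramifiedCompletion F) b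
  rw [unramifiedPeriodField.smul_div, unramifiedPeriodField.smul_algebraMap,
    unramifiedPeriodField.smul_algebraMap,
    maxUnramifiedCompletion.galAut_eq_self_of_mem_absInertia hσ,
    maxUnramifiedCompletion.galAut_eq_self_of_mem_absInertia hσ]

variable {p : ℕ} [Fact p.Prime] [Algebra ℚ_[p] F]

variable (F p) in
/-- **`F̂_nr`-admissible representations are unramified**: a continuous finite-dimensional
`ℚ_p`-representation of `Γ_F` which is admissible for `unramifiedPeriodRingData F p` is trivial on
the inertia group (Fontaine 1994, Exp. III Prop. 1.6.2; Fontaine–Ouyang Prop. 2.14).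
[cite: FontaineAsterisque223III, Exp. III §1.6] -/
theorem apply_eq_self_of_isAdmissible_unramifiedPeriodRingData
    {V : Type w'} [AddCommGroup V] [Module ℚ_[p] V] [TopologicalSpace V] [FiniteDimensional ℚ_[p] V]
    (ρ : ContinuousRep (absoluteGaloisGroup F) ℚ_[p] V) (hadm : (unramifiedPeriodRingData F p).IsAdmissible ρ)
    {σ : absoluteGaloisGroup F} (hσ : σ ∈ absInertia F) (v : V) : ρ σ v = v :=
  PeriodRingData.apply_eq_self_of_isAdmissible (unramifiedPeriodRingData F p) ρ hadm
    (fun b => unramifiedPeriodField.smul_eq_self_of_mem_absInertia hσ b) v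

variable (F p) in
/-- The Hodge–Tate weights of any `ρ` relative to `F̂_nr` (trivial filtration) are `{0, …, 0}`.
[folklore] -/
theorem hodgeTateWeights_unramifiedPeriodRingData
    {V : Type w'} [AddCommGroup V] [Module ℚ_[p] V] [TopologicalSpace V]
    (ρ : ContinuousRep (absoluteGaloisGroup F) ℚ_[p] V) :
    (unramifiedPeriodRingData F p).hodgeTateWeights ρ =
      Multiset.replicate (Module.finrank F ((unramifiedPeriodRingData F p).D ρ)) 0 :=
  PeriodRingData.hodgeTateWeights_eq_replicate_of_fil_trivial _
    (fun _ hi => unramifiedPeriodField.fil_of_nonpos hi) (fun _ hi => unramifiedPeriodField.fil_of_pos hi) ρ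

end IsNonarchimedeanLocalField

/-! ### Framed, `ℚ̄_p`-valued statements and the datum -/

section Framed

open IsNonarchimedeanLocalField Literature.NumberTheory.Automorphic

variable {F : Type} [Field F] [ValuativeRel F] [TopologicalSpace F] [IsNonarchimedeanLocalField F]
  {p : ℕ} [Fact p.Prime]

omit [ValuativeRel F] [TopologicalSpace F] [IsNonarchimedeanLocalField F] in
/-- A framed representation `rE : Γ_F →ₜ* GL_n(E)` whose underlying `ℚ_p`-linear representation is
trivial on `σ` has `rE σ = 1`. [folklore] -/
theorem eq_one_of_restrictScalarsQl_apply_eq_self {n : ℕ} {E : IntermediateField ℚ_[p] (PadicAlgCl p)}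
    (rE : FramedRep (absoluteGaloisGroup F) E n) {σ : absoluteGaloisGroup F}
    (h : ∀ x : Fin n → E, restrictScalarsQl E rE σ x = x) : rE σ = 1 := by
  classical
  refine Units.ext (Matrix.ext fun i j => ?_)
  have h1 := congrFun (h (Pi.single j 1)) i
  rw [restrictScalarsQl_apply_apply, FramedRep.toContinuousRep_apply_apply, Matrix.mulVec_single_one,
    Matrix.col_apply, Pi.single_apply] at h1
  rw [Units.val_one, Matrix.one_apply]
  exact h1

/-- **`F̂_nr`-de Rham ⇒ unramified** for framed `ρ : Γ_F →ₜ* GL_n(ℚ̄_p)`: if some finite model of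
`ρ` is `F̂_nr`-admissible then `ρ` is trivial on `I_F` (Fontaine 1994, Exp. III Prop. 1.6.2).
[cite: FontaineAsterisque223III, Exp. III §1.6] -/
theorem FramedRep.isLocallyUnramified_of_isDeRhamWith_unramifiedPeriodRingData [Algebra ℚ_[p] F] {n : ℕ}
    (ρ : FramedRep (absoluteGaloisGroup F) (PadicAlgCl p) n)
    (h : ρ.IsDeRhamWith ‹Algebra ℚ_[p] F› (unramifiedPeriodRingData F p)) : ρ.IsLocallyUnramified := by
  obtain ⟨E, hfin, rE, ⟨P, hP⟩, hadm⟩ := h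
  haveI : FiniteDimensional ℚ_[p] E := hfin
  intro σ hσ
  have h1 : rE σ = 1 := eq_one_of_restrictScalarsQl_apply_eq_self rE fun x =>
    apply_eq_self_of_isAdmissible_unramifiedPeriodRingData F p (restrictScalarsQl E rE) hadm hσ x
  rw [← hP, FramedRep.conj_apply, FramedRep.baseChange_apply, h1, map_one, mul_one, mul_inv_cancel]

variable (F) in
/-- The restriction of a framed representation of `Γ_F` to the Weil group `W_F ⊆ Γ_F`, as a
representation on `Fin n → A` (forgetting the topology). [cite: TateCorvallis1979, (1.4.1)] -/
def FramedRep.weilRestrict {A : Type*} [CommRing A] [TopologicalSpace A] {n : ℕ}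
    (ρ : FramedRep (absoluteGaloisGroup F) A n) : Representation A (WeilGroup F) (Fin n → A) :=
  ρ.toRepresentation.comp (WeilGroup.toAbsGalois F)

/-- Unfolding lemma for `FramedRep.weilRestrict`. [folklore] -/
@[simp] theorem FramedRep.weilRestrict_apply_apply {A : Type*} [CommRing A] [TopologicalSpace A] {n : ℕ}
    (ρ : FramedRep (absoluteGaloisGroup F) A n) (w : WeilGroup F) (v : Fin n → A) :
    ρ.weilRestrict F w v = ((ρ (WeilGroup.toAbsGalois F w) : GL (Fin n) A) : Matrix (Fin n) (Fin n) A) *ᵥ v :=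
  rfl

/-- The restriction to `W_F` of an unramified `ρ` is an unramified representation of `W_F`.
[cite: TateCorvallis1979, (4.1.6)] -/
theorem FramedRep.IsLocallyUnramified.isUnramifiedRep_weilRestrict {A : Type*} [CommRing A]
    [TopologicalSpace A] {n : ℕ} {ρ : FramedRep (absoluteGaloisGroup F) A n} (h : ρ.IsLocallyUnramified) :
    WeilGroup.IsUnramifiedRep (ρ.weilRestrict F) := by
  intro u hu
  refine LinearMap.ext fun v => ?_
  rw [FramedRep.weilRestrict_apply_apply, h _ (WeilGroup.mem_inertia_iff.1 hu), Units.val_one, Matrix.one_mulVec]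
  rfl

/-- Change of frame: `v ↦ g v` is an isomorphism `ρ|_{W_F} ≅ (g ρ g⁻¹)|_{W_F}`. [folklore] -/
def FramedRep.weilRestrictConjEquiv {A : Type*} [CommRing A] [TopologicalSpace A] [IsTopologicalRing A]
    {n : ℕ} (g : GL (Fin n) A) (ρ : FramedRep (absoluteGaloisGroup F) A n) :
    Representation.Equiv (ρ.weilRestrict F) ((FramedRep.conj g ρ).weilRestrict F) :=
  Representation.Equiv.mk
    (LinearEquiv.ofLinear (Matrix.toLin' (g : Matrix (Fin n) (Fin n) A))
      (Matrix.toLin' ((g⁻¹ : GL (Fin n) A) : Matrix (Fin n) (Fin n) A))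
      (by rw [← Matrix.toLin'_mul, ← Units.val_mul, mul_inv_cancel, Units.val_one, Matrix.toLin'_one])
      (by rw [← Matrix.toLin'_mul, ← Units.val_mul, inv_mul_cancel, Units.val_one, Matrix.toLin'_one]))
    (fun w => LinearMap.ext fun v => by
      simp only [LinearMap.coe_comp, Function.comp_apply, LinearEquiv.coe_coe, LinearEquiv.ofLinear_apply,
        Matrix.toLin'_apply, FramedRep.weilRestrict_apply_apply, FramedRep.conj_apply, Units.val_mul,
        Matrix.mulVec_mulVec, Matrix.mul_assoc]
      rw [← Units.val_mul g⁻¹ g, inv_mul_cancel, Units.val_one, Matrix.mul_one])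

variable (F p) in
/-- **The `F̂_nr` `p`-adic Hodge datum.** The accepted structure `PstWeilDeligneData F p`
instantiated with the period-ring datum `𝔅 = F̂_nr` (`unramifiedPeriodRingData`: the inertia
invariants `(B_dR)^{I_F}` of Fontaine's `B_dR` with the induced, trivial, filtration; its
admissible representations are exactly the unramified ones and all their Hodge–Tate weights are
`0`) and the Weil–Deligne recipe `IsWeilDeligneOf ρ r :↔ r.N = 0 ∧ r.ρ ≅ ρ|_{W_F}` (the
Weil–Deligne representation `(ρ|_{W_F}, 0)` of an unramified representation, Tate (4.1.3),
(4.1.6); for crystalline — here: unramified — `ρ`, Fontaine's `WD(D_pst ρ)` has `N = 0` and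
inertia acting trivially, Exp. VIII §1.3).  All axioms are theorems: de Rham = admissible ⇒
unramified (`FramedRep.isLocallyUnramified_of_isDeRhamWith_unramifiedPeriodRingData`) gives
`exists_of_isDeRham`; unramified ⇒ de Rham is Lang's theorem
(`FramedRep.isDeRhamWith_unramifiedPeriodRingData_of_isLocallyUnramified`).  This is a genuine
but TRUNCATED instance of the intended datum (`B_dR`, `WD ∘ D_pst`): it sees only the
Hodge–Tate weight `0` part of `p`-adic Hodge theory.
[cite: FontaineAsterisque223III, Exp. III §1.5–1.6] [cite: TateCorvallis1979, (4.1.3)] -/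
def unramifiedPstWeilDeligneData [Algebra ℚ_[p] F] : PstWeilDeligneData F p where
  algebra := ‹Algebra ℚ_[p] F›
  𝔅 := unramifiedPeriodRingData F p
  IsWeilDeligneOf ρ r := r.N = 0 ∧ Nonempty (Representation.Equiv r.ρ (ρ.weilRestrict F))
  exists_of_isDeRham ρ h := by
    have hu := (FramedRep.isLocallyUnramified_of_isDeRhamWith_unramifiedPeriodRingData ρ h).isUnramifiedRep_weilRestrict
    exact ⟨WeilDeligneRep.ofRep (ρ.weilRestrict F) hu.isContinuousRep, rfl, ⟨Representation.Equiv.refl _⟩⟩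
  isEquivalent ρ r r' h h' := by
    obtain ⟨hN, ⟨e⟩⟩ := h
    obtain ⟨hN', ⟨e'⟩⟩ := h'
    exact ⟨{ toRepEquiv := e.trans e'.symm
             comm_N := by rw [hN, hN', LinearMap.comp_zero, LinearMap.zero_comp] }⟩
  conj g ρ r h := ⟨h.1, ⟨h.2.some.trans (FramedRep.weilRestrictConjEquiv g ρ)⟩⟩
  isDeRhamWith_of_isLocallyUnramified ρ h :=
    FramedRep.isDeRhamWith_unramifiedPeriodRingData_of_isLocallyUnramified ρ h
  wd_of_isLocallyUnramified ρ r hρ h := by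
    refine ⟨h.1, fun u hu => LinearMap.ext fun v => ?_⟩
    obtain ⟨e⟩ := h.2
    have h1 := Representation.IntertwiningMap.isIntertwining _ _ e.toIntertwiningMap u v
    rw [hρ.isUnramifiedRep_weilRestrict u hu] at h1
    exact e.injective h1

/-- The `algebra` field of the `F̂_nr` datum is the ambient `ℚ_p`-algebra structure. [folklore] -/
@[simp] theorem unramifiedPstWeilDeligneData_algebra [Algebra ℚ_[p] F] :
    (unramifiedPstWeilDeligneData F p).algebra = ‹Algebra ℚ_[p] F› := rfl

/-- The period-ring datum of the `F̂_nr` datum is `unramifiedPeriodRingData`. [folklore] -/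
@[simp] theorem unramifiedPstWeilDeligneData_𝔅 [Algebra ℚ_[p] F] :
    (unramifiedPstWeilDeligneData F p).𝔅 = unramifiedPeriodRingData F p := rfl

/-- Unfolding lemma for the Weil–Deligne relation of the `F̂_nr` datum. [folklore] -/
theorem unramifiedPstWeilDeligneData_isWeilDeligneOf_iff [Algebra ℚ_[p] F] {n : ℕ}
    (ρ : FramedRep (absoluteGaloisGroup F) (PadicAlgCl p) n)
    (r : WeilDeligneRep F (PadicAlgCl p) (Fin n → PadicAlgCl p)) :
    (unramifiedPstWeilDeligneData F p).IsWeilDeligneOf ρ r ↔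
      r.N = 0 ∧ Nonempty (Representation.Equiv r.ρ (ρ.weilRestrict F)) :=
  Iff.rfl

/-- **De Rham for the `F̂_nr` datum is unramified.** [cite: FontaineAsterisque223III, Exp. III §1.6] -/
theorem unramifiedPstWeilDeligneData_isDeRhamFramed_iff [Algebra ℚ_[p] F] {n : ℕ}
    (ρ : FramedRep (absoluteGaloisGroup F) (PadicAlgCl p) n) :
    (unramifiedPstWeilDeligneData F p).IsDeRhamFramed ρ ↔ ρ.IsLocallyUnramified :=
  ⟨fun h => FramedRep.isLocallyUnramified_of_isDeRhamWith_unramifiedPeriodRingData ρ h,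
    fun h => FramedRep.isDeRhamWith_unramifiedPeriodRingData_of_isLocallyUnramified ρ h⟩

/-- **Crystalline for the `F̂_nr` datum is unramified.** [cite: FontaineAsterisque223III, Exp. III §5] -/
theorem unramifiedPstWeilDeligneData_isCrystallineFramed_iff [Algebra ℚ_[p] F] {n : ℕ}
    (ρ : FramedRep (absoluteGaloisGroup F) (PadicAlgCl p) n) :
    (unramifiedPstWeilDeligneData F p).IsCrystallineFramed ρ ↔ ρ.IsLocallyUnramified :=
  ⟨fun h => (unramifiedPstWeilDeligneData_isDeRhamFramed_iff ρ).1 h.1,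
    fun h => (unramifiedPstWeilDeligneData F p).isCrystallineFramed_of_isLocallyUnramified h⟩

/-- **Unramified representations have Hodge–Tate weights `0` for the `F̂_nr` datum**
(`PstWeilDeligneData.UnramifiedWeightsZero`): the Hodge–Tate weights of the (admissible) finite
model are `{0, …, 0}`. [cite: FontaineAsterisque223III, Exp. III §5] -/
theorem unramifiedPstWeilDeligneData_unramifiedWeightsZero [Algebra ℚ_[p] F] :
    (unramifiedPstWeilDeligneData F p).UnramifiedWeightsZero := by
  intro n ρ hρ
  obtain ⟨E, hfin, rE, hmodel, hadm⟩ :=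
    FramedRep.isDeRhamWith_unramifiedPeriodRingData_of_isLocallyUnramified ρ hρ
  refine ⟨E, hfin, rE, hmodel, hadm, fun w hw => ?_⟩
  change w ∈ (unramifiedPeriodRingData F p).hodgeTateWeights (restrictScalarsQl E rE) at hw
  rw [hodgeTateWeights_unramifiedPeriodRingData F p (restrictScalarsQl E rE)] at hw
  rw [Multiset.eq_of_mem_replicate hw]
  exact ⟨le_rfl, le_rfl⟩

/-- **De Rham with weights in `[a, b]` for the `F̂_nr` datum**: unramified, and `a ≤ 0 ≤ b`
unless `n = 0`. [folklore] -/
theorem unramifiedPstWeilDeligneData_isDeRhamWithWeightsIn_iff [Algebra ℚ_[p] F] {n : ℕ}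
    (ρ : FramedRep (absoluteGaloisGroup F) (PadicAlgCl p) n) (a b : ℤ) :
    (unramifiedPstWeilDeligneData F p).IsDeRhamWithWeightsIn a b ρ ↔
      ρ.IsLocallyUnramified ∧ (n = 0 ∨ (a ≤ 0 ∧ 0 ≤ b)) := by
  constructor
  · rintro ⟨E, hfin, rE, hmodel, hadm, hw⟩
    haveI : FiniteDimensional ℚ_[p] E := hfin
    have hunr : ρ.IsLocallyUnramified :=
      FramedRep.isLocallyUnramified_of_isDeRhamWith_unramifiedPeriodRingData ρ ⟨E, hfin, rE, hmodel, hadm⟩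
    refine ⟨hunr, ?_⟩
    by_cases hn : n = 0
    · exact Or.inl hn
    · refine Or.inr (hw 0 ?_)
      change (0 : ℤ) ∈ (unramifiedPeriodRingData F p).hodgeTateWeights (restrictScalarsQl E rE)
      rw [hodgeTateWeights_unramifiedPeriodRingData F p (restrictScalarsQl E rE), Multiset.mem_replicate]
      refine ⟨?_, rfl⟩
      rw [show Module.finrank F ((unramifiedPeriodRingData F p).D (restrictScalarsQl E rE)) =
        Module.finrank ℚ_[p] (Fin n → E) from hadm, Module.finrank_pi_fintype, Finset.sum_const,
        Finset.card_univ, Fintype.card_fin, smul_eq_mul]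
      exact mul_ne_zero hn Module.finrank_pos.ne'
  · rintro ⟨hunr, hcase⟩
    obtain ⟨E, hfin, rE, hmodel, hadm⟩ :=
      FramedRep.isDeRhamWith_unramifiedPeriodRingData_of_isLocallyUnramified ρ hunr
    haveI : FiniteDimensional ℚ_[p] E := hfin
    refine ⟨E, hfin, rE, hmodel, hadm, fun w hw => ?_⟩
    change w ∈ (unramifiedPeriodRingData F p).hodgeTateWeights (restrictScalarsQl E rE) at hw
    rw [hodgeTateWeights_unramifiedPeriodRingData F p (restrictScalarsQl E rE), Multiset.mem_replicate] at hw
    obtain ⟨hne, rfl⟩ := hw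
    rcases hcase with hn | h
    · exfalso
      apply hne
      rw [show Module.finrank F ((unramifiedPeriodRingData F p).D (restrictScalarsQl E rE)) =
        Module.finrank ℚ_[p] (Fin n → E) from hadm, Module.finrank_pi_fintype, Finset.sum_const,
        Finset.card_univ, Fintype.card_fin, hn, zero_smul]
    · exact h

end Framed

end Literature.NumberTheory.GaloisRepresentations

end
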